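import Summits.QuantumFields.BalabanUV.Beta.D1BFx.SliceTransferDefectHess
import Summits.QuantumFields.BalabanUV.Beta.D1BFx.SliceTransferDefectWardJetMix

/-!
# `BalabanUV.Beta.D1BFx.SliceTransferSources` — road «BF-x» for binder row D1, slot (K), identity side: **«(A1) v2 WITH SOURCES» STEP 1 —
# K-TA4G's SLICE TRANSFER WITH THE WARD FAILURES DISPLAYED IN CLOSED FORM** (generic, honest SYMMETRIC form jets, co-frame weight): with ONLY the
# order-zero letter `K₀·W₀ = 0`, the constraint letters and the determinants,
#   `hessT (M_T⁻¹|_{ν⊕μ}; kkt D̃ₛ Qₛ, kkt D̃ₜ Qₜ, kkt D̃ₛₜ Qₛₜ) + hessT (Φ₀⁻¹; Φₛ + Zₛ, Φₜ + Zₜ, Φₛₜ + Zₛₜ)`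
#   `= hessT ((kkt (K₀+B₀) Q₀)⁻¹; kkt (K•+B•) Q•) + 2·hessT ((τW₀)⁻¹; τW•)`,
# where the sharp side sees the DEFLATED jets `D̃ₛ = Kₛ − (Eₛ𝒫₀ᵀ + 𝒫₀Eₛᵀ) + 𝒫₀Zₛ𝒫₀ᵀ`, `D̃ₛₜ = Kₛₜ − (27 words)` (leaf-04-g8's PART 2d∕2e) and the
# FP-Gram side the sandwiches `Zₛ = W₀ᵀEₛ`, `Zₛₜ = WₛᵀEₜ + WₜᵀEₛ + W₀ᵀEₛₜ` of the failures `Eₛ = KₛW₀ + K₀Wₛ`, `Eₛₜ = KₛₜW₀ + KₛWₜ + KₜWₛ + K₀Wₛₜ`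
# — `MixedVarPackedHess.hessT_sliceTransfer_jets` is the case `E• = 0`

HONEST DEPENDENCY (cell records, verbatim): «continuum YM on T⁴ ⇐ BetaPertH ∧ nine spine estimates (0/9 proved); BetaPertH ⇐ (D1) ∧ (D4) ∧
CAP+tail; G-an2-4 gates asym, D1 and NE2/3/4.»  HONEST FRAMING (cell contract, verbatim): «discharging `BetaPertH` makes Bałaban's UV stability
UNCONDITIONAL — a real constructive-QFT result; it is NOT the continuum limit and NOT the Clay problem.»  THIS MODULE DISCHARGES NOTHING of (K),
of D1 or of the wall: [folklore] ONE assembly BY NAME of the road owner's ∕ leaf-04-g8's defect chain — `SliceTransferDefectHess.hessT_defect_transfer_jets`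
(PART 2b: NO Ward letter), `SliceTransferDefect.defect_eq_zero` + `SliceTransferDefectWard.rank_of_coframe` (the order-zero defect vanishes),
`SliceTransferDefectWardJetMix.deflJet₁_add_eq_wardFailure` + `SliceTransferDefectWard.deflJet₁_coframe` (PART 2d∕2e order one),
`SliceTransferDefectWardJetMix.deflJetMix_coframe_eq_wardFailure` (PART 2e mixed), `SliceTransferDefectWard.gram₁_eq_ward` ∕ `gramMix_eq_ward` ∕
`gram₁_add_weight` ∕ `gramMix_add_weight` (the FP-Gram sandwiches).  No `def`, no `def … : Prop`, nothing cited, 0 sorry; ABSTRACT data only.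
0 binders discharged; (K) NOT closed; NOT D1, NOT BetaPertH, NOT continuum, NOT Clay.

ABSOLUTE RULE (cell charter, verbatim): «No internally-minted statement may enter as a cited fact. Every hypothesis is either kernel-proved in this
package or a verbatim quotation of a PUBLISHED theorem with page reference. The manuscript(s) under audit are NOT citable for their own disputed
steps — they are the thing under adjudication; programme-internal (2001/route/tribunal) claims are never citable.»

WHY (owner RULING ρ-g11-10 l.32717: «(A1) v2 PARAMETRIC in the read-out weight … statement-first»; my plan line).  (A1)
`KCombineCovStripped.hessKer_transfer_road_cov_stripped` rests on the stripped transfer `KCombineCovColour.hessT_transfer_wardL_stripped`, which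
rests (through the colour lift) on `KCombineCov.hessT_transfer_wardL` = K-TA4G WITH the eighteen Ward binders.  «WARD-L WITH SOURCES» (`WardJetsSources*`)
shows the one-sided binders `aₛ aₜ aₛₜ` CARRY SOURCES for single-bond directions; so v2 needs K-TA4G WITHOUT the `a•` letters, the failures
displayed.  The defect chain (K8-L) already contains every piece; this file assembles them into the ONE identity v2's colour lift∕strip (STEP 2),
dictionary∕towers (STEP 3) and parametric torus words (STEP 4) will consume.  The failures `E•` enter as FREE SYMBOLS named by hypothesis-
equations — no read-out convention, no parity: STEP 2 lifts parity-typed colourless jets to this symmetric setting (`c ⊗ kₛ`, failure `c ⊗ Eₛ`).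
CONTENT (all [folklore]): §1 `gram₁_add_eq_sandwich`, `gramMix_add_eq_sandwich` (the FP-Gram jets of `K + B` = those of `B` + the sandwiches, under
`K₀W₀ = 0`); `deflJet₁_coframe_eq_wardFailure` (order one for a co-frame weight: `= Kₛ − (Eₛ𝒫₀ᵀ + 𝒫₀Eₛᵀ) + 𝒫₀Zₛ𝒫₀ᵀ`); `defect_coframe_eq_zero`;
§2 **`hessT_transfer_src`** — the slice transfer with sources.  NOT HERE (honest): the colour lift∕strip (STEP 2), the dictionary and the `ℤ⁴`
limits (STEP 3), the parametric∕midpoint torus words (STEP 4), any evaluation of `E•` (that is «WARD-L WITH SOURCES»: `WardJetsSourcesTorus`).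
Unit `b2b-balaban-beta-d1-formalise-leaf-03` (gen 14), D1 formalisation swarm LEAF PROVER 03; road owner `b2b-balaban-beta-d1-p2`.
-/

noncomputable section

namespace Summit.QuantumFields.BalabanUV.Beta.D1BFx.SliceTransferSources

open Matrix
open Literature.MathematicalPhysics.QuantumFieldTheory.Balaban1983to89.Beta.Composition (kkt)
open Summit.QuantumFields.BalabanUV.Beta.D1BFx.MixedVarPackedHess (hessT)
open Summit.QuantumFields.BalabanUV.Beta.D1BFx.GramWeightJets (gram₀ gram₁)
open Summit.QuantumFields.BalabanUV.Beta.D1BFx.GramWeightJetsMixed (gramMix)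
open Summit.QuantumFields.BalabanUV.Beta.D1BFx.SliceTransferDefect (defect defect_eq_zero gram_add_of_ward)
open Summit.QuantumFields.BalabanUV.Beta.D1BFx.SliceTransferDefectJets (deflJet₁ deflJetMix gram₁_transpose_of_symm gramMix_transpose_of_symm)
open Summit.QuantumFields.BalabanUV.Beta.D1BFx.SliceTransferDefectWard (rank_of_coframe deflJet₁_coframe gram₁_eq_ward gramMix_eq_ward gram₁_add_weight
  gramMix_add_weight)
open Summit.QuantumFields.BalabanUV.Beta.D1BFx.SliceTransferDefectHess (hessT_defect_transfer_jets)
open Summit.QuantumFields.BalabanUV.Beta.D1BFx.SliceTransferDefectWardJetMix (deflJet₁_add_eq_wardFailure deflJetMix_coframe_eq_wardFailure)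

variable {ν μ ρ : Type*} [Fintype ν] [Fintype μ] [Fintype ρ] [DecidableEq ν] [DecidableEq μ] [DecidableEq ρ]

/-! ## §1 The pieces in the letters of the transfer -/

omit [Fintype μ] [Fintype ρ] [DecidableEq ν] [DecidableEq μ] [DecidableEq ρ] in
/-- [folklore] **THE FIRST FP-GRAM JET OF `K + B` IS THAT OF `B` PLUS THE SANDWICH** `Zₛ = W₀ᵀEₛ` (`K₀W₀ = 0` only). -/
theorem gram₁_add_eq_sandwich (K₀ Kₛ B₀ Bₛ : Matrix ν ν ℝ) (W₀ Wₛ Eₛ : Matrix ν ρ ℝ) (Zₛ : Matrix ρ ρ ℝ) (a0 : K₀ * W₀ = 0)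
    (hEₛ : Eₛ = Kₛ * W₀ + K₀ * Wₛ) (hZₛ : Zₛ = W₀ᵀ * Eₛ) :
    gram₁ W₀ Wₛ (K₀ + B₀) (Kₛ + Bₛ) = gram₁ W₀ Wₛ B₀ Bₛ + Zₛ := by
  rw [gram₁_add_weight, gram₁_eq_ward W₀ Wₛ K₀ Kₛ, a0, Matrix.mul_zero, zero_add, hZₛ, hEₛ, add_comm]

omit [Fintype μ] [Fintype ρ] [DecidableEq ν] [DecidableEq μ] [DecidableEq ρ] in
/-- [folklore] **THE MIXED FP-GRAM JET OF `K + B` IS THAT OF `B` PLUS THE SANDWICHES** `Zₛₜ = WₛᵀEₜ + WₜᵀEₛ + W₀ᵀEₛₜ` (`K₀W₀ = 0` only). -/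
theorem gramMix_add_eq_sandwich (K₀ Kₛ Kₜ Kₛₜ B₀ Bₛ Bₜ Bₛₜ : Matrix ν ν ℝ) (W₀ Wₛ Wₜ Wₛₜ Eₛ Eₜ Eₛₜ : Matrix ν ρ ℝ) (Zₛₜ : Matrix ρ ρ ℝ)
    (a0 : K₀ * W₀ = 0) (hEₛ : Eₛ = Kₛ * W₀ + K₀ * Wₛ) (hEₜ : Eₜ = Kₜ * W₀ + K₀ * Wₜ)
    (hEₛₜ : Eₛₜ = Kₛₜ * W₀ + Kₛ * Wₜ + Kₜ * Wₛ + K₀ * Wₛₜ) (hZₛₜ : Zₛₜ = Wₛᵀ * Eₜ + Wₜᵀ * Eₛ + W₀ᵀ * Eₛₜ) :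
    gramMix W₀ Wₛ Wₜ Wₛₜ (K₀ + B₀) (Kₛ + Bₛ) (Kₜ + Bₜ) (Kₛₜ + Bₛₜ) = gramMix W₀ Wₛ Wₜ Wₛₜ B₀ Bₛ Bₜ Bₛₜ + Zₛₜ := by
  rw [gramMix_add_weight, gramMix_eq_ward W₀ Wₛ Wₜ Wₛₜ K₀ Kₛ Kₜ Kₛₜ, a0, Matrix.mul_zero, zero_add, hZₛₜ, hEₛ, hEₜ, hEₛₜ, add_comm]

omit [Fintype μ] [DecidableEq ν] [DecidableEq μ] in
/-- [folklore] **THE FIRST DEFLATED JET OF `K + B` FOR A CO-FRAME WEIGHT, THROUGH THE FAILURE** (PART 2e's `deflJet₁_add_eq_wardFailure` with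
PART 2c's `deflJet₁_coframe`): `deflJet₁ (K₀+B₀) (Kₛ+Bₛ) W₀ Wₛ = Kₛ − (Eₛ𝒫₀ᵀ + 𝒫₀Eₛᵀ) + 𝒫₀Zₛ𝒫₀ᵀ`, `B• = gram•(T, A)`, `𝒫₀ = B₀W₀P`, `P = (gram₀ W₀ B₀)⁻¹`. -/
theorem deflJet₁_coframe_eq_wardFailure (K₀ Kₛ : Matrix ν ν ℝ) (T₀ Tₛ : Matrix ρ ν ℝ) (A₀ Aₛ : Matrix ρ ρ ℝ) (W₀ Wₛ Eₛ P₀ : Matrix ν ρ ℝ)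
    (P Zₛ : Matrix ρ ρ ℝ) (hK₀ : K₀ᵀ = K₀) (hKₛ : Kₛᵀ = Kₛ) (hA₀ : A₀ᵀ = A₀) (hAₛ : Aₛᵀ = Aₛ) (hTW : (T₀ * W₀).det ≠ 0) (hA : A₀.det ≠ 0)
    (a0 : K₀ * W₀ = 0) (hEₛ : Eₛ = Kₛ * W₀ + K₀ * Wₛ) (hZₛ : Zₛ = W₀ᵀ * Eₛ) (hP : P = (gram₀ W₀ (gram₀ T₀ A₀))⁻¹)
    (hP₀ : P₀ = gram₀ T₀ A₀ * W₀ * P) :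
    deflJet₁ (K₀ + gram₀ T₀ A₀) (Kₛ + gram₁ T₀ Tₛ A₀ Aₛ) W₀ Wₛ = Kₛ - (Eₛ * P₀ᵀ + P₀ * Eₛᵀ) + P₀ * Zₛ * P₀ᵀ := by
  have hB₀ : (gram₀ T₀ A₀)ᵀ = gram₀ T₀ A₀ := by
    simp only [gram₀, Matrix.transpose_mul, Matrix.transpose_transpose, hA₀, Matrix.mul_assoc]
  have hBₛ : (gram₁ T₀ Tₛ A₀ Aₛ)ᵀ = gram₁ T₀ Tₛ A₀ Aₛ := gram₁_transpose_of_symm T₀ Tₛ hA₀ hAₛ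
  rw [deflJet₁_add_eq_wardFailure K₀ Kₛ (gram₀ T₀ A₀) (gram₁ T₀ Tₛ A₀ Aₛ) W₀ Wₛ Eₛ P₀ P Zₛ hK₀ hKₛ hB₀ hBₛ a0 hEₛ hZₛ hP hP₀,
    deflJet₁_coframe T₀ Tₛ A₀ Aₛ W₀ Wₛ hA₀ hAₛ hTW hA, add_zero]

omit [Fintype μ] [DecidableEq ν] [DecidableEq μ] in
/-- [folklore] **THE ORDER-ZERO DEFECT OF A CO-FRAME WEIGHT VANISHES** under `K₀W₀ = 0` (`defect_eq_zero` + the rank identity `rank_of_coframe`). -/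
theorem defect_coframe_eq_zero (K₀ : Matrix ν ν ℝ) (T₀ : Matrix ρ ν ℝ) (A₀ : Matrix ρ ρ ℝ) (W₀ : Matrix ν ρ ℝ) (hK₀ : K₀ᵀ = K₀)
    (hTW : (T₀ * W₀).det ≠ 0) (hA : A₀.det ≠ 0) (a0 : K₀ * W₀ = 0) : defect K₀ (gram₀ T₀ A₀) W₀ = 0 :=
  defect_eq_zero hK₀ W₀ a0 (rank_of_coframe T₀ A₀ W₀ (isUnit_iff_ne_zero.2 hTW) (isUnit_iff_ne_zero.2 hA))

/-! ## §2 The slice transfer with sources -/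

/-- [folklore] **K-TA4G's SLICE TRANSFER WITH THE WARD FAILURES DISPLAYED** («(A1) v2» STEP 1).  Honest SYMMETRIC form jets `K₀ Kₛ Kₜ Kₛₜ`,
co-frame data `T•`, symmetric `A•`, gauge-mode jets `W•`, constraint jets `Q•` with the kinematic letters `b0 bₛ bₜ bₛₜ`, constant comb rows `τ`;
ONLY the order-zero letter `K₀·W₀ = 0`; `T₀W₀`, `A₀`, `Φ₀ = W₀ᵀ(K₀+B₀)W₀`, `τW₀`, `kkt K₀ [Q₀; τ]` invertible.  With the weight jets `B• = gram•(T, A)`,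
the failures `Eₛ = KₛW₀ + K₀Wₛ`, `Eₜ`, `Eₛₜ = KₛₜW₀ + KₛWₜ + KₜWₛ + K₀Wₛₜ`, `F• = B•W₀ + B₀W•`, `P = (gram₀ W₀ B₀)⁻¹`, `𝒫₀ = B₀W₀P`, the FP-Gram jets
`Φ• = gram•(W, B)` and the sandwiches `Zₛ = W₀ᵀEₛ`, `Zₜ = W₀ᵀEₜ`, `Zₛₜ = WₛᵀEₜ + WₜᵀEₛ + W₀ᵀEₛₜ` (all named by hypothesis-equations):
the sharp-slice one-loop functional AT THE DEFLATED JETS `D̃ₛ := Kₛ − (Eₛ𝒫₀ᵀ + 𝒫₀Eₛᵀ) + 𝒫₀Zₛ𝒫₀ᵀ`, `D̃ₜ`, `D̃ₛₜ := Kₛₜ − (27 words)` plus the FP-Gram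
functional AT `Φ• + Z•` equals the weighted one-loop functional plus twice the comb Gram one.  `hessT_sliceTransfer_jets` ∕ `hessT_gramTransfer_jets`
is the case `E• = 0` (then `D̃• = K•`, `Z• = 0`). -/
theorem hessT_transfer_src (K₀ Kₛ Kₜ Kₛₜ : Matrix ν ν ℝ) (T₀ Tₛ Tₜ Tₛₜ : Matrix ρ ν ℝ) (A₀ Aₛ Aₜ Aₛₜ : Matrix ρ ρ ℝ)
    (W₀ Wₛ Wₜ Wₛₜ : Matrix ν ρ ℝ) (Q₀ Qₛ Qₜ Qₛₜ : Matrix μ ν ℝ) (τ : Matrix ρ ν ℝ)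
    (B₀ Bₛ Bₜ Bₛₜ : Matrix ν ν ℝ) (Eₛ Eₜ Eₛₜ Fₛ Fₜ P₀ : Matrix ν ρ ℝ) (P Φₛ Φₜ Φₛₜ Zₛ Zₜ Zₛₜ : Matrix ρ ρ ℝ)
    (hK₀ : K₀ᵀ = K₀) (hKₛ : Kₛᵀ = Kₛ) (hKₜ : Kₜᵀ = Kₜ) (hKₛₜ : Kₛₜᵀ = Kₛₜ)
    (hA₀ : A₀ᵀ = A₀) (hAₛ : Aₛᵀ = Aₛ) (hAₜ : Aₜᵀ = Aₜ) (hAₛₜ : Aₛₜᵀ = Aₛₜ)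
    (a0 : K₀ * W₀ = 0)
    (b0 : Q₀ * W₀ = 0) (bₛ : Qₛ * W₀ + Q₀ * Wₛ = 0) (bₜ : Qₜ * W₀ + Q₀ * Wₜ = 0)
    (bₛₜ : Qₛₜ * W₀ + Qₛ * Wₜ + Qₜ * Wₛ + Q₀ * Wₛₜ = 0)
    (hTW : (T₀ * W₀).det ≠ 0) (hA : A₀.det ≠ 0) (hΦ : (gram₀ W₀ (K₀ + gram₀ T₀ A₀)).det ≠ 0) (hτ : (τ * W₀).det ≠ 0)
    (hM : (kkt K₀ (fromRows Q₀ τ)).det ≠ 0)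
    -- the named letters
    (hB₀ : B₀ = gram₀ T₀ A₀) (hBₛ : Bₛ = gram₁ T₀ Tₛ A₀ Aₛ) (hBₜ : Bₜ = gram₁ T₀ Tₜ A₀ Aₜ)
    (hBₛₜ : Bₛₜ = gramMix T₀ Tₛ Tₜ Tₛₜ A₀ Aₛ Aₜ Aₛₜ)
    (hEₛ : Eₛ = Kₛ * W₀ + K₀ * Wₛ) (hEₜ : Eₜ = Kₜ * W₀ + K₀ * Wₜ) (hEₛₜ : Eₛₜ = Kₛₜ * W₀ + Kₛ * Wₜ + Kₜ * Wₛ + K₀ * Wₛₜ)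
    (hFₛ : Fₛ = Bₛ * W₀ + B₀ * Wₛ) (hFₜ : Fₜ = Bₜ * W₀ + B₀ * Wₜ)
    (hP : P = (gram₀ W₀ B₀)⁻¹) (hP₀ : P₀ = B₀ * W₀ * P)
    (hΦₛ : Φₛ = gram₁ W₀ Wₛ B₀ Bₛ) (hΦₜ : Φₜ = gram₁ W₀ Wₜ B₀ Bₜ) (hΦₛₜ : Φₛₜ = gramMix W₀ Wₛ Wₜ Wₛₜ B₀ Bₛ Bₜ Bₛₜ)
    (hZₛ : Zₛ = W₀ᵀ * Eₛ) (hZₜ : Zₜ = W₀ᵀ * Eₜ) (hZₛₜ : Zₛₜ = Wₛᵀ * Eₜ + Wₜᵀ * Eₛ + W₀ᵀ * Eₛₜ) :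
    hessT ((kkt K₀ (fromRows Q₀ τ))⁻¹.submatrix (Sum.map id Sum.inl) (Sum.map id Sum.inl))
        (kkt (Kₛ - (Eₛ * P₀ᵀ + P₀ * Eₛᵀ) + P₀ * Zₛ * P₀ᵀ) Qₛ)
        (kkt (Kₜ - (Eₜ * P₀ᵀ + P₀ * Eₜᵀ) + P₀ * Zₜ * P₀ᵀ) Qₜ)
        (kkt (Kₛₜ
          - (Eₛₜ * P₀ᵀ + P₀ * Eₛₜᵀ - P₀ * Zₛₜ * P₀ᵀ)
          - (Eₛ * P * Fₜᵀ + Fₜ * P * Eₛᵀ - Eₛ * P * Φₜ * P₀ᵀ - P₀ * Φₜ * P * Eₛᵀ - Fₜ * P * Zₛ * P₀ᵀ - P₀ * Zₛ * P * Fₜᵀ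
              + P₀ * Zₛ * P * Φₜ * P₀ᵀ + P₀ * Φₜ * P * Zₛ * P₀ᵀ)
          - (Fₛ * P * Eₜᵀ + Eₜ * P * Fₛᵀ - Fₛ * P * Zₜ * P₀ᵀ - P₀ * Zₜ * P * Fₛᵀ - Eₜ * P * Φₛ * P₀ᵀ - P₀ * Φₛ * P * Eₜᵀ
              + P₀ * Φₛ * P * Zₜ * P₀ᵀ + P₀ * Zₜ * P * Φₛ * P₀ᵀ)
          - (Eₛ * P * Eₜᵀ + Eₜ * P * Eₛᵀ - Eₛ * P * Zₜ * P₀ᵀ - P₀ * Zₜ * P * Eₛᵀ - Eₜ * P * Zₛ * P₀ᵀ - P₀ * Zₛ * P * Eₜᵀ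
              + P₀ * Zₛ * P * Zₜ * P₀ᵀ + P₀ * Zₜ * P * Zₛ * P₀ᵀ)) Qₛₜ)
      + hessT (gram₀ W₀ (K₀ + B₀))⁻¹ (Φₛ + Zₛ) (Φₜ + Zₜ) (Φₛₜ + Zₛₜ)
    = hessT (kkt (K₀ + B₀) Q₀)⁻¹ (kkt (Kₛ + Bₛ) Qₛ) (kkt (Kₜ + Bₜ) Qₜ) (kkt (Kₛₜ + Bₛₜ) Qₛₜ)
      + 2 * hessT (τ * W₀)⁻¹ (τ * Wₛ) (τ * Wₜ) (τ * Wₛₜ) := by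
  -- symmetry of the weight jets
  have hB₀s : B₀ᵀ = B₀ := by
    rw [hB₀]; simp only [gram₀, Matrix.transpose_mul, Matrix.transpose_transpose, hA₀, Matrix.mul_assoc]
  have hBₛs : Bₛᵀ = Bₛ := by rw [hBₛ]; exact gram₁_transpose_of_symm T₀ Tₛ hA₀ hAₛ
  have hBₜs : Bₜᵀ = Bₜ := by rw [hBₜ]; exact gram₁_transpose_of_symm T₀ Tₜ hA₀ hAₜ
  have hBₛₜs : Bₛₜᵀ = Bₛₜ := by rw [hBₛₜ]; exact gramMix_transpose_of_symm T₀ Tₛ Tₜ Tₛₜ hA₀ hAₛ hAₜ hAₛₜ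
  -- the order-zero defect vanishes: the sharp leg is `kkt K₀ [Q₀; τ]`
  have hd0 : defect K₀ B₀ W₀ = 0 := by rw [hB₀]; exact defect_coframe_eq_zero K₀ T₀ A₀ W₀ hK₀ hTW hA a0
  have hΦ' : (gram₀ W₀ (K₀ + B₀)).det ≠ 0 := by rw [hB₀]; exact hΦ
  have hM' : (kkt (K₀ + defect K₀ B₀ W₀) (fromRows Q₀ τ)).det ≠ 0 := by rw [hd0, add_zero]; exact hM
  -- PART 2b (NO Ward letter on the form)
  have h := hessT_defect_transfer_jets K₀ Kₛ Kₜ Kₛₜ B₀ Bₛ Bₜ Bₛₜ W₀ Wₛ Wₜ Wₛₜ Q₀ Qₛ Qₜ Qₛₜ τ hK₀ hKₛ hKₜ hKₛₜ hB₀s hBₛs hBₜs hBₛₜs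
    b0 bₛ bₜ bₛₜ hΦ' hτ hM'
  -- the deflated jets through the failures (PART 2d∕2e) and the FP-Gram jets through the sandwiches
  have hP' : P = (gram₀ W₀ (gram₀ T₀ A₀))⁻¹ := by rw [hP, hB₀]
  have hP₀' : P₀ = gram₀ T₀ A₀ * W₀ * P := by rw [hP₀, hB₀]
  have h1s : deflJet₁ (K₀ + B₀) (Kₛ + Bₛ) W₀ Wₛ = Kₛ - (Eₛ * P₀ᵀ + P₀ * Eₛᵀ) + P₀ * Zₛ * P₀ᵀ := by
    rw [hB₀, hBₛ]
    exact deflJet₁_coframe_eq_wardFailure K₀ Kₛ T₀ Tₛ A₀ Aₛ W₀ Wₛ Eₛ P₀ P Zₛ hK₀ hKₛ hA₀ hAₛ hTW hA a0 hEₛ hZₛ hP' hP₀'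
  have h1t : deflJet₁ (K₀ + B₀) (Kₜ + Bₜ) W₀ Wₜ = Kₜ - (Eₜ * P₀ᵀ + P₀ * Eₜᵀ) + P₀ * Zₜ * P₀ᵀ := by
    rw [hB₀, hBₜ]
    exact deflJet₁_coframe_eq_wardFailure K₀ Kₜ T₀ Tₜ A₀ Aₜ W₀ Wₜ Eₜ P₀ P Zₜ hK₀ hKₜ hA₀ hAₜ hTW hA a0 hEₜ hZₜ hP' hP₀'
  have hFₛ' : Fₛ = gram₁ T₀ Tₛ A₀ Aₛ * W₀ + gram₀ T₀ A₀ * Wₛ := by rw [hFₛ, hBₛ, hB₀]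
  have hFₜ' : Fₜ = gram₁ T₀ Tₜ A₀ Aₜ * W₀ + gram₀ T₀ A₀ * Wₜ := by rw [hFₜ, hBₜ, hB₀]
  have hΦₛ' : Φₛ = gram₁ W₀ Wₛ (gram₀ T₀ A₀) (gram₁ T₀ Tₛ A₀ Aₛ) := by rw [hΦₛ, hB₀, hBₛ]
  have hΦₜ' : Φₜ = gram₁ W₀ Wₜ (gram₀ T₀ A₀) (gram₁ T₀ Tₜ A₀ Aₜ) := by rw [hΦₜ, hB₀, hBₜ]
  have hΦₛₜ' : Φₛₜ = gramMix W₀ Wₛ Wₜ Wₛₜ (gram₀ T₀ A₀) (gram₁ T₀ Tₛ A₀ Aₛ) (gram₁ T₀ Tₜ A₀ Aₜ) (gramMix T₀ Tₛ Tₜ Tₛₜ A₀ Aₛ Aₜ Aₛₜ) := by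
    rw [hΦₛₜ, hB₀, hBₛ, hBₜ, hBₛₜ]
  have h1st := deflJetMix_coframe_eq_wardFailure K₀ Kₛ Kₜ Kₛₜ T₀ Tₛ Tₜ Tₛₜ A₀ Aₛ Aₜ Aₛₜ W₀ Wₛ Wₜ Wₛₜ Eₛ Eₜ Eₛₜ Fₛ Fₜ P₀ P Φₛ Φₜ Φₛₜ
    Zₛ Zₜ Zₛₜ hK₀ hKₛ hKₜ hKₛₜ hA₀ hAₛ hAₜ hAₛₜ hTW hA a0 hEₛ hEₜ hEₛₜ hFₛ' hFₜ' hP' hP₀' hΦₛ' hΦₜ' hΦₛₜ' hZₛ hZₜ hZₛₜ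
  rw [← hB₀, ← hBₛ, ← hBₜ, ← hBₛₜ] at h1st
  have h2s : gram₁ W₀ Wₛ (K₀ + B₀) (Kₛ + Bₛ) = Φₛ + Zₛ := by
    rw [gram₁_add_eq_sandwich K₀ Kₛ B₀ Bₛ W₀ Wₛ Eₛ Zₛ a0 hEₛ hZₛ, hΦₛ]
  have h2t : gram₁ W₀ Wₜ (K₀ + B₀) (Kₜ + Bₜ) = Φₜ + Zₜ := by
    rw [gram₁_add_eq_sandwich K₀ Kₜ B₀ Bₜ W₀ Wₜ Eₜ Zₜ a0 hEₜ hZₜ, hΦₜ]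
  have h2st : gramMix W₀ Wₛ Wₜ Wₛₜ (K₀ + B₀) (Kₛ + Bₛ) (Kₜ + Bₜ) (Kₛₜ + Bₛₜ) = Φₛₜ + Zₛₜ := by
    rw [gramMix_add_eq_sandwich K₀ Kₛ Kₜ Kₛₜ B₀ Bₛ Bₜ Bₛₜ W₀ Wₛ Wₜ Wₛₜ Eₛ Eₜ Eₛₜ Zₛₜ a0 hEₛ hEₜ hEₛₜ hZₛₜ, hΦₛₜ]
  rw [hd0, add_zero, h1s, h1t, h1st, h2s, h2t, h2st] at h
  exact h

end Summit.QuantumFields.BalabanUV.Beta.D1BFx.SliceTransferSources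

end
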